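import Literature.MathematicalPhysics.QuantumFieldTheory.Balaban1983to89.B6Ineq2140KLevelPadV1
import Literature.MathematicalPhysics.QuantumFieldTheory.Balaban1983to89.B6GDVaLegKLevelV1
import HarnessLib

/-!
# `Balaban1983to89.B6Ineq2140GradKLevelCensusV1` — T. Bałaban, *Propagators and renormalization transformations for lattice gauge theories. II*,
# Commun. Math. Phys. **96** (1984) 223–250 [Balaban1984PropagatorsII], Proposition 2.6, THE `L²` ENTRIES (2.140)₂ `‖ζ∇GJ‖` AND (2.140)₃ `‖ζG∇*J‖`
# p. 247 AT k LEVELS FOR THE GENUINE `G = Δ_a⁻¹` ON THE V1 TORUS, IN THE SHAPES OF r03's CENSUS `B6Prop26Census2140KLevelV1` (slots hl1, hl2),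
# MODULO THE SUP ENTRY (2.136)₃ DISPLAYED IN THE SHAPE OF r03's CENSUS `B6Prop26Census2136KLevelV1` (slot h3) — the Schur test on one block pair
# from the landed sup entry (2.136)₂ and the displayed (2.136)₃, which are each other's transposes (`G† = G`)

statement-level skeleton of published theorems with citation tags; proofs where landed; nothing here is a claim about the Yang–Mills mass gap

WHAT IS PRINTED (p. 247 [PDF 25], Proposition 2.6, verbatim up to notation; render `b2b-balaban-ref1/pages/1984-cmp96-propagators-rt-II/
1984-cmp96-propagators-rt-II-p025-x2.png`): *"|(GJ)(x)|, |(∇GJ)(x)|, |(G∇*J)(x)|, |(ΔGJ)(x)| ≤ O(1)[(Lʲη)², Lʲη, Lʲη, 1]e^{−δ₃d(y,y′)}|J| (2.136) for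
x ∈ Δ(y), y ∈ Λ_j, supp J ⊂ Δ(y′) … ‖ζGJ‖, ‖ζ∇GJ‖, ‖ζG∇*J‖, ‖ζ∇G∇*J‖, ‖ζ∇∇GJ‖, ‖ζG∇*∇*J‖ ≤ O(1)[(Lʲη)², Lʲη, Lʲη, 1, 1, 1]|ζ|e^{−δ₃d(y,y′)}‖J‖
(2.140) if supp ζ ⊂ Δ(y), y ∈ Λ_j, supp J ⊂ Δ(y′), with the constant O(1) depending on d and L."*

CITATION HEADER (lean-in-tree rule) — WHAT IS REPRODUCED.  Phase-2 file of the `lit-balaban` typed skeleton (HOME `run/shared/lean/pub/lit-balaban/`),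
seat **p22 gen 30** (census slots hl1/hl2 assigned to p22: r03 → p22 INBOX 2026-08-24T08:55Z «your READY slots l2 1, 2», p27 HOME/STATUS 15:05Z); SKELETON
row **B6.Prop2.6** (member cells only; the head is r03's).  Sibling of this seat's `B6Ineq2140KLevelV1` (p368613 ✓: the Schur test on one block pair
`sum_sq_cut_apply_le_of_hasMajorant_pair`, `adjoint_GE`, `absorb_of_threshold`) and `B6Ineq2140KLevelPadV1` (p369… ✓: `sum_sq_le_of_hasMajorant_pair_len` =
the Schur step for a transpose pair with `len`-prefactor majorants, `len_le_of_levelGap`; its §3 did (2.140)₂ for the PADDED family modulo a (2.136)₃-shape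
majorant of an abstract `T′`).  THIS FILE = THE PLACED-FAMILY VERSIONS IN THE CENSUS SHAPES, with the transpose identified:
* §1 **`single_GDVa_eq_DVG_single`** — the kernel of `G∇*_ν = onFun G ∘ DVa ν c′` is the transpose of the kernel of `∇_νG = DV ν c′ ∘ onFun G`
  (`B6OpTransposeV1.tr_mul`/`tr_onFun`/`tr_apply_single`, p38's `B6GDVaLegKLevelV1.tr_DV : tr (DV ν c′) = DVa ν c′`, `B6Ineq2140KLevelV1.adjoint_GE : G† = G`);
* §2 **`ineq2140_grad_kLevel_census_of_h3`** — r03's census slot **hl1** `∃ δ A M₂ N₁, … Σ_x (ζ(x)(∇_νGJ)(x))² ≤ (A·(len y·|c′|⁻¹)·e^{−δd_T(y,y′)}·s)²·Σ_x J(x)²`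
  (binders of `B6Prop26Census2140KLevelV1.prop26_census2140_kLevel_of_l2` VERBATIM) FROM the displayed input **h3** of `B6Prop26Census2136KLevelV1.
  prop26_census2136_kLevel_of_div` VERBATIM (the k-level sup majorant `A′·(len y·|c′|⁻¹)·e^{−δ′d_T}` of `onFun G ∘ DVa ν c′`, p38's (2.136)₃ lane) and the
  LANDED (2.136)₂ `B6Prop26GradKLevelV1.prop26_2136_grad_kLevel_unconditional` (second conjunct, `σ := σ₁`, `α := ½`) BY NAME: both majorants weakened to
  the common rate `min(δ₃(½, 2σ₁), δ′)` and constant `max(A, A′)`, then `sum_sq_le_of_hasMajorant_pair_len`; threshold `M₂ := max(M₂, M₂′, 2 log L/δ + 1)`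
  (`absorb_of_threshold`), `N₁ := N₁′`;
* §3 **`ineq2140_gradT_kLevel_census_of_h3`** — r03's census slot **hl2** (operator `onFun G ∘ DVa ν c′`) from the same two inputs with the roles of `T`, `T′`
  exchanged.
So r03's `prop26_census2140_kLevel_of_l2` closes with `hl1 := ineq2140_grad_kLevel_census_of_h3 hb₀ hb₁ h3`, `hl2 := ineq2140_gradT_kLevel_census_of_h3 hb₀ hb₁ h3`
from the SAME term `h3` it already displays in `prop26_census2136_kLevel_of_div` (p38's (2.136)₃ producer, conformance re-verified by r03 2026-08-24T15:28Z),
and `hl4`, `hl5` from this seat's `B6Ineq2140Grad2KLevelV1` (in flight); `hl3` (`∇G∇*`) stays displayed (GAPS G-B6-2140-456).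
HONEST SCOPE / DIVERGENCES.  (1) CONDITIONAL on the displayed (2.136)₃ input `h3` (a hypothesis binder in r03's printed shape, not a vendored fact; the sup
entry (2.136)₃ at k levels is p38's `B6Prop26MirrorAssemblyV1` lane, pending).  (2) Print derives (2.140) through the walk (2.141) summed in `L²`; here the two
first-order entries are DERIVED from the sup entries (2.136)₂,₃ by the Schur test — a shorter road valid for these entries only (their kernels are absolutely
summable; the second-order entries are not reachable this way).  (3) Unweighted `ℓ²` sums over the fine bonds on both sides (print's `η^d` weights cancel);
rate `min(δ₃(½,2σ₁), δ′)/2` and constant `max(A,A′)·L` OURS (print: «O(1) depending on d and L», «δ₃ depending on d and L only»; ours depend on the band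
`b₀, b₁` too).  (4) V1 torus, `k ≥ 2`, `M_h = L^a ≥ 8`, `R ≥ 2L²`, `P′ ≥ 5`, odd `L ≥ 5`, cubes placed, weights in the band (2.16) — r03's census setting.
IMPORTS BY NAME, restating nothing; THEOREMS ONLY (no definition, no `def … : Prop`); standard axioms.  NOT summit progress.  Unit `lit-balaban-p22`
(gen 30), 2026-08-24.
-/

noncomputable section

open scoped BigOperators
open Finset

namespace Literature.MathematicalPhysics.QuantumFieldTheory.Balaban1983to89.B6Ineq2140GradKLevelCensusV1

open LatticeFieldCalculus
open B6RandomWalk (HasMajorant hasMajorant_mono delta3 delta3_pos)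
open B6Ineq2133TwoScaleV1 (onFun)
open B6SectAOperatorsV1 (BondIdx)
open B6SectAVectorModelV1 (GE)
open B6MultiLevelBoxOperator (N0)
open B6MultiLevelTorusOperator (TDomains)
open B6Geom246MultiLevelTorus (geomT)
open B6GlobalChartV1 (PV domT blkV1)
open B6Cover236MultiLevelBlocks (cubes)
open B6CubeWindowV1 (Placed GlobalBand)
open B6GradLegKLevelV1 (DV)
open B6LapLegKLevelV1 (DVa)
open B6OpTransposeV1 (tr tr_mul tr_onFun tr_apply_single)
open B6GDVaLegKLevelV1 (tr_DV)
open B6Prop26GradKLevelV1 (prop26_2136_grad_kLevel_unconditional)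
open B6Ineq2140KLevelV1 (adjoint_GE absorb_of_threshold geomT_dist_nonneg)
open B6Ineq2140KLevelPadV1 (sum_sq_le_of_hasMajorant_pair_len geomT_len_eq)

variable {d ℓ : ℕ} {hd : 1 ≤ d + 1} {hL : Odd (ℓ + 1) ∧ 1 < ℓ + 1} {b₀ b₁ : ℝ} {m K : ℕ} {Mh k R : ℕ} {P' : Fin (d + 1) → ℕ}

/-! ## §1  `G∇*_ν` is the transpose of `∇_νG` -/

/-- the kernel of the transpose: `(tr T)δ_x(x′) = Tδ_{x′}(x)`. [cite: Balaban1984PropagatorsII, (2.51)–(2.52) p.232 (operators and their kernels); dictionary] -/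
theorem tr_single_apply {X : Type} [Fintype X] [DecidableEq X] (T : Module.End ℝ (X → ℝ)) (x x' : X) :
    tr T (Pi.single x 1) x' = T (Pi.single x' 1) x := by
  rw [tr_apply_single]
  simp [dotProduct, Pi.single_apply]

/-- `(∇_νG)ᵀ = G∇*_ν` for the genuine `G = Δ_a⁻¹`: `tr (DV ν c′ ∘ onFun G) = onFun G ∘ DVa ν c′` (`tr_DV`, `G† = G`).
[cite: Balaban1984PropagatorsII, (2.8) p.224 («the adjoint operator ∇*»), (2.22) p.226; dictionary] -/
theorem tr_DV_GE (hN : ∀ μ, N0 ℓ Mh k P' μ = (PV d ℓ m K hd hL).sitesPerDir 0) (D : TDomains d ℓ Mh k P' R) (hk : k ≤ m + K)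
    {cf : ℝ} (hcf : cf ≠ 0) {w : BondIdx (domT hN D hk) → ℝ} (hw : ∀ i, 0 < w i) (ν : Fin (d + 1)) :
    tr (DV (P := PV d ℓ m K hd hL) ν cf ∘ₗ onFun (GE (domT hN D hk) hcf hw)) = onFun (GE (domT hN D hk) hcf hw) ∘ₗ DVa ν cf := by
  rw [← Module.End.mul_eq_comp, ← Module.End.mul_eq_comp, tr_mul, tr_DV, tr_onFun, adjoint_GE]

/-- **THE KERNEL OF `G∇*_ν` IS THE TRANSPOSE OF THE KERNEL OF `∇_νG`**: `(G∇*_ν δ_x)(x′) = (∇_νG δ_{x′})(x)`.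
[cite: Balaban1984PropagatorsII, (2.8) p.224, (2.51)–(2.52) p.232 (operators and their kernels); dictionary] -/
theorem single_GDVa_eq_DVG_single (hN : ∀ μ, N0 ℓ Mh k P' μ = (PV d ℓ m K hd hL).sitesPerDir 0) (D : TDomains d ℓ Mh k P' R) (hk : k ≤ m + K)
    {cf : ℝ} (hcf : cf ≠ 0) {w : BondIdx (domT hN D hk) → ℝ} (hw : ∀ i, 0 < w i) (ν : Fin (d + 1))
    (x x' : PBond (PV d ℓ m K hd hL) 0) :
    (onFun (GE (domT hN D hk) hcf hw) ∘ₗ DVa ν cf) (Pi.single x 1) x' = (DV ν cf ∘ₗ onFun (GE (domT hN D hk) hcf hw)) (Pi.single x' 1) x := by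
  classical
  rw [← tr_DV_GE hN D hk hcf hw ν, tr_single_apply]

/-! ## §2  Census slot hl1: (2.140)₂ `‖ζ∇_νGJ‖` at k levels from the displayed (2.136)₃ and the landed (2.136)₂ -/

/-- rate weakening of an exponential kernel. [folklore] -/
private theorem exp_le_exp_of_rate {ρ σ t : ℝ} (h : σ ≤ ρ) (ht : 0 ≤ t) : Real.exp (-(ρ * t)) ≤ Real.exp (-(σ * t)) :=
  Real.exp_le_exp.2 (by nlinarith)

/-- weakening a `len`-prefactor majorant kernel to a larger constant and a smaller rate. [cite: Balaban1984PropagatorsII, (2.53) p.232 (monotonicity of majorants); bookkeeping] -/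
private theorem kernel_mono (D : TDomains d ℓ Mh k P' R) (cf : ℝ) {A B ρ σ : ℝ} (hAB : A ≤ B) (hB : 0 ≤ B) (hσρ : σ ≤ ρ)
    (y y' : (geomT D).Site) :
    A * ((geomT D).len y * |cf|⁻¹) * Real.exp (-(ρ * (geomT D).dist y y')) ≤
      B * ((geomT D).len y * |cf|⁻¹) * Real.exp (-(σ * (geomT D).dist y y')) := by
  have hl : 0 ≤ (geomT D).len y * |cf|⁻¹ := mul_nonneg (by rw [geomT_len_eq]; positivity) (inv_nonneg.mpr (abs_nonneg _))
  exact mul_le_mul (mul_le_mul_of_nonneg_right hAB hl) (exp_le_exp_of_rate hσρ (geomT_dist_nonneg D y y')) (Real.exp_nonneg _)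
    (mul_nonneg hB hl)

open Classical in
/-- **PROPOSITION 2.6, THE `L²` ENTRY (2.140)₂ `‖ζ∇GJ‖ ≤ O(1)Lʲη|ζ|e^{−δ₃d(y,y′)}‖J‖` AT k LEVELS FOR THE GENUINE `G` — r03's CENSUS SLOT hl1 VERBATIM, FROM
THE DISPLAYED SUP ENTRY (2.136)₃ (r03's census2136 slot h3 VERBATIM) AND THE LANDED (2.136)₂** (`prop26_2136_grad_kLevel_unconditional`, `σ := σ₁`,
`α := ½`): the Schur test on one block pair for the transpose pair `∇_νG`, `G∇*_ν` (§1), level factor `len y′ ≤ L·e^{(δ/2)d_T}·len y` absorbed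
(`sum_sq_le_of_hasMajorant_pair_len`). [cite: Balaban1984PropagatorsII, Prop. 2.6 (2.140) p.247 (second entry), (2.136) p.247, (2.2) p.224] -/
theorem ineq2140_grad_kLevel_census_of_h3 (hb₀ : 0 < b₀) (hb₁ : b₀ ≤ b₁)
    (h3 : ∃ (δ A M₂ : ℝ) (N₁ : ℕ), 0 < δ ∧ 0 ≤ A ∧ 0 < M₂ ∧
      ∀ (m K : ℕ) {Mh k R : ℕ} {P' : Fin (d + 1) → ℕ}
        (hN : ∀ μ, N0 ℓ Mh k P' μ = (PV d ℓ m K hd hL).sitesPerDir 0) (D : TDomains d ℓ Mh k P' R) (hk : k ≤ m + K) (_ : 2 ≤ k)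
        {a : ℕ} (_ : Mh = (ℓ + 1) ^ a) (_ : 8 ≤ Mh) (_ : 2 * (ℓ + 1) ^ 2 ≤ R) (_ : ∀ μ, 5 ≤ P' μ) (_ : 4 ≤ ℓ)
        (_ : ∀ c : ↥(cubes D.toDomains), Placed ℓ k P' c.1) (_ : M₂ ≤ ((ℓ : ℝ) + 1) * Mh) (_ : N₁ + 1 ≤ R * ((ℓ + 1) * Mh))
        {cf : ℝ} (hcf : cf ≠ 0) {w : BondIdx (domT hN D hk) → ℝ} (hw : ∀ i, 0 < w i) (_ : GlobalBand b₀ b₁ cf w) (ν : Fin (d + 1)),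
        HasMajorant (g := geomT D) (blkV1 hN D) (onFun (GE (domT hN D hk) hcf hw) ∘ₗ DVa ν cf)
          (fun y y' => A * ((geomT D).len y * |cf|⁻¹) * Real.exp (-(δ * (geomT D).dist y y')))) :
    ∃ (δ A M₂ : ℝ) (N₁ : ℕ), 0 < δ ∧ 0 ≤ A ∧ 0 < M₂ ∧
      ∀ (m K : ℕ) {Mh k R : ℕ} {P' : Fin (d + 1) → ℕ}
        (hN : ∀ μ, N0 ℓ Mh k P' μ = (PV d ℓ m K hd hL).sitesPerDir 0) (D : TDomains d ℓ Mh k P' R) (hk : k ≤ m + K) (_ : 2 ≤ k)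
        {a : ℕ} (_ : Mh = (ℓ + 1) ^ a) (_ : 8 ≤ Mh) (_ : 2 * (ℓ + 1) ^ 2 ≤ R) (_ : ∀ μ, 5 ≤ P' μ) (_ : 4 ≤ ℓ)
        (_ : ∀ c : ↥(cubes D.toDomains), Placed ℓ k P' c.1) (_ : M₂ ≤ ((ℓ : ℝ) + 1) * Mh) (_ : N₁ + 1 ≤ R * ((ℓ + 1) * Mh))
        {cf : ℝ} (hcf : cf ≠ 0) {w : BondIdx (domT hN D hk) → ℝ} (hw : ∀ i, 0 < w i) (_ : GlobalBand b₀ b₁ cf w)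
        (ν : Fin (d + 1)) (y y' : (geomT D).Site) (ζ J : PBond (PV d ℓ m K hd hL) 0 → ℝ) {s : ℝ} (_ : 0 ≤ s)
        (_ : ∀ x, blkV1 hN D x ≠ y → ζ x = 0) (_ : ∀ x, |ζ x| ≤ s) (_ : ∀ x, blkV1 hN D x ≠ y' → J x = 0),
        ∑ x, (ζ x * (DV ν cf ∘ₗ onFun (GE (domT hN D hk) hcf hw)) J x) ^ 2 ≤
          (A * ((geomT D).len y * |cf|⁻¹) * Real.exp (-(δ * (geomT D).dist y y')) * s) ^ 2 * ∑ x, J x ^ 2 := by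
  obtain ⟨δ', A', M₂', N₁', hδ', hA', hM₂', hF3⟩ := h3
  obtain ⟨σ₁, hσ₁, hF⟩ := prop26_2136_grad_kLevel_unconditional d ℓ hd hL hb₀ hb₁
  obtain ⟨A, M₂, hA, hM₂, hF2⟩ := hF σ₁ hσ₁ le_rfl (1 / 2) (by norm_num) (by norm_num)
  have hδ₂ : 0 < delta3 (1 / 2) (2 * σ₁) := delta3_pos (by norm_num) (by linarith)
  have hδm0 : 0 < min (delta3 (1 / 2) (2 * σ₁)) δ' := lt_min hδ₂ hδ'
  refine ⟨min (delta3 (1 / 2) (2 * σ₁)) δ' / 2, max A A' * ((ℓ : ℝ) + 1),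
    max (max M₂ M₂') (2 * Real.log ((ℓ : ℝ) + 1) / min (delta3 (1 / 2) (2 * σ₁)) δ' + 1), N₁', by positivity,
    mul_nonneg (le_max_of_le_left hA) (by positivity), lt_max_of_lt_left (lt_max_of_lt_left hM₂), ?_⟩
  intro m K Mh k R P' hN D hk hk2 a hMha hM8 hR2 hP5 hℓ hpl hM hRM cf hcf w hw hwb ν y y' ζ J s _hs hζ hζs hJ
  have hT := (hF2 m K hN D hk hk2 hMha hM8 hR2 hP5 hℓ hpl (((le_max_left _ _).trans (le_max_left _ _)).trans hM) hcf hw hwb).2 ν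
  have hT' := hF3 m K hN D hk hk2 hMha hM8 hR2 hP5 hℓ hpl (((le_max_right _ _).trans (le_max_left _ _)).trans hM) hRM hcf hw hwb ν
  have habs := absorb_of_threshold (R := R) hδm0 (by omega) (by omega) hR2 ((le_max_right _ _).trans hM)
  have hB0 : 0 ≤ max A A' := le_max_of_le_left hA
  have hTm := hasMajorant_mono (g := geomT D) (blkV1 hN D) hT
    (fun y₁ y₂ => kernel_mono D cf (le_max_left A A') hB0 (min_le_left (delta3 (1 / 2) (2 * σ₁)) δ') y₁ y₂)
  have hTm' := hasMajorant_mono (g := geomT D) (blkV1 hN D) hT'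
    (fun y₁ y₂ => kernel_mono D cf (le_max_right A A') hB0 (min_le_right (delta3 (1 / 2) (2 * σ₁)) δ') y₁ y₂)
  exact sum_sq_le_of_hasMajorant_pair_len hN D (by omega) (fun μ => le_trans (by norm_num) (hP5 μ)) cf
    (fun x x' => single_GDVa_eq_DVG_single hN D hk hcf hw ν x x') hB0 hδm0.le habs hTm hTm' y y' ζ J hζ hζs hJ

/-! ## §3  Census slot hl2: (2.140)₃ `‖ζG∇*_νJ‖` at k levels from the same two inputs -/

open Classical in
/-- **PROPOSITION 2.6, THE `L²` ENTRY (2.140)₃ `‖ζG∇*J‖ ≤ O(1)Lʲη|ζ|e^{−δ₃d(y,y′)}‖J‖` AT k LEVELS FOR THE GENUINE `G` — r03's CENSUS SLOT hl2 VERBATIM, FROM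
THE DISPLAYED SUP ENTRY (2.136)₃ (census2136 slot h3 VERBATIM) AND THE LANDED (2.136)₂**: the Schur test of §2 with the roles of `∇_νG` and `G∇*_ν`
exchanged. [cite: Balaban1984PropagatorsII, Prop. 2.6 (2.140) p.247 (third entry), (2.136) p.247, (2.2) p.224] -/
theorem ineq2140_gradT_kLevel_census_of_h3 (hb₀ : 0 < b₀) (hb₁ : b₀ ≤ b₁)
    (h3 : ∃ (δ A M₂ : ℝ) (N₁ : ℕ), 0 < δ ∧ 0 ≤ A ∧ 0 < M₂ ∧
      ∀ (m K : ℕ) {Mh k R : ℕ} {P' : Fin (d + 1) → ℕ}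
        (hN : ∀ μ, N0 ℓ Mh k P' μ = (PV d ℓ m K hd hL).sitesPerDir 0) (D : TDomains d ℓ Mh k P' R) (hk : k ≤ m + K) (_ : 2 ≤ k)
        {a : ℕ} (_ : Mh = (ℓ + 1) ^ a) (_ : 8 ≤ Mh) (_ : 2 * (ℓ + 1) ^ 2 ≤ R) (_ : ∀ μ, 5 ≤ P' μ) (_ : 4 ≤ ℓ)
        (_ : ∀ c : ↥(cubes D.toDomains), Placed ℓ k P' c.1) (_ : M₂ ≤ ((ℓ : ℝ) + 1) * Mh) (_ : N₁ + 1 ≤ R * ((ℓ + 1) * Mh))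
        {cf : ℝ} (hcf : cf ≠ 0) {w : BondIdx (domT hN D hk) → ℝ} (hw : ∀ i, 0 < w i) (_ : GlobalBand b₀ b₁ cf w) (ν : Fin (d + 1)),
        HasMajorant (g := geomT D) (blkV1 hN D) (onFun (GE (domT hN D hk) hcf hw) ∘ₗ DVa ν cf)
          (fun y y' => A * ((geomT D).len y * |cf|⁻¹) * Real.exp (-(δ * (geomT D).dist y y')))) :
    ∃ (δ A M₂ : ℝ) (N₁ : ℕ), 0 < δ ∧ 0 ≤ A ∧ 0 < M₂ ∧
      ∀ (m K : ℕ) {Mh k R : ℕ} {P' : Fin (d + 1) → ℕ}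
        (hN : ∀ μ, N0 ℓ Mh k P' μ = (PV d ℓ m K hd hL).sitesPerDir 0) (D : TDomains d ℓ Mh k P' R) (hk : k ≤ m + K) (_ : 2 ≤ k)
        {a : ℕ} (_ : Mh = (ℓ + 1) ^ a) (_ : 8 ≤ Mh) (_ : 2 * (ℓ + 1) ^ 2 ≤ R) (_ : ∀ μ, 5 ≤ P' μ) (_ : 4 ≤ ℓ)
        (_ : ∀ c : ↥(cubes D.toDomains), Placed ℓ k P' c.1) (_ : M₂ ≤ ((ℓ : ℝ) + 1) * Mh) (_ : N₁ + 1 ≤ R * ((ℓ + 1) * Mh))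
        {cf : ℝ} (hcf : cf ≠ 0) {w : BondIdx (domT hN D hk) → ℝ} (hw : ∀ i, 0 < w i) (_ : GlobalBand b₀ b₁ cf w)
        (ν : Fin (d + 1)) (y y' : (geomT D).Site) (ζ J : PBond (PV d ℓ m K hd hL) 0 → ℝ) {s : ℝ} (_ : 0 ≤ s)
        (_ : ∀ x, blkV1 hN D x ≠ y → ζ x = 0) (_ : ∀ x, |ζ x| ≤ s) (_ : ∀ x, blkV1 hN D x ≠ y' → J x = 0),
        ∑ x, (ζ x * (onFun (GE (domT hN D hk) hcf hw) ∘ₗ DVa ν cf) J x) ^ 2 ≤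
          (A * ((geomT D).len y * |cf|⁻¹) * Real.exp (-(δ * (geomT D).dist y y')) * s) ^ 2 * ∑ x, J x ^ 2 := by
  obtain ⟨δ', A', M₂', N₁', hδ', hA', hM₂', hF3⟩ := h3
  obtain ⟨σ₁, hσ₁, hF⟩ := prop26_2136_grad_kLevel_unconditional d ℓ hd hL hb₀ hb₁
  obtain ⟨A, M₂, hA, hM₂, hF2⟩ := hF σ₁ hσ₁ le_rfl (1 / 2) (by norm_num) (by norm_num)
  have hδ₂ : 0 < delta3 (1 / 2) (2 * σ₁) := delta3_pos (by norm_num) (by linarith)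
  have hδm0 : 0 < min (delta3 (1 / 2) (2 * σ₁)) δ' := lt_min hδ₂ hδ'
  refine ⟨min (delta3 (1 / 2) (2 * σ₁)) δ' / 2, max A A' * ((ℓ : ℝ) + 1),
    max (max M₂ M₂') (2 * Real.log ((ℓ : ℝ) + 1) / min (delta3 (1 / 2) (2 * σ₁)) δ' + 1), N₁', by positivity,
    mul_nonneg (le_max_of_le_left hA) (by positivity), lt_max_of_lt_left (lt_max_of_lt_left hM₂), ?_⟩
  intro m K Mh k R P' hN D hk hk2 a hMha hM8 hR2 hP5 hℓ hpl hM hRM cf hcf w hw hwb ν y y' ζ J s _hs hζ hζs hJ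
  have hT := (hF2 m K hN D hk hk2 hMha hM8 hR2 hP5 hℓ hpl (((le_max_left _ _).trans (le_max_left _ _)).trans hM) hcf hw hwb).2 ν
  have hT' := hF3 m K hN D hk hk2 hMha hM8 hR2 hP5 hℓ hpl (((le_max_right _ _).trans (le_max_left _ _)).trans hM) hRM hcf hw hwb ν
  have habs := absorb_of_threshold (R := R) hδm0 (by omega) (by omega) hR2 ((le_max_right _ _).trans hM)
  have hB0 : 0 ≤ max A A' := le_max_of_le_left hA
  have hTm := hasMajorant_mono (g := geomT D) (blkV1 hN D) hT
    (fun y₁ y₂ => kernel_mono D cf (le_max_left A A') hB0 (min_le_left (delta3 (1 / 2) (2 * σ₁)) δ') y₁ y₂)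
  have hTm' := hasMajorant_mono (g := geomT D) (blkV1 hN D) hT'
    (fun y₁ y₂ => kernel_mono D cf (le_max_right A A') hB0 (min_le_right (delta3 (1 / 2) (2 * σ₁)) δ') y₁ y₂)
  exact sum_sq_le_of_hasMajorant_pair_len hN D (by omega) (fun μ => le_trans (by norm_num) (hP5 μ)) cf
    (fun x x' => (single_GDVa_eq_DVG_single hN D hk hcf hw ν x' x).symm) hB0 hδm0.le habs hTm' hTm y y' ζ J hζ hζs hJ

end Literature.MathematicalPhysics.QuantumFieldTheory.Balaban1983to89.B6Ineq2140GradKLevelCensusV1
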